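import Mathlib
import Literature.Geometry.Riemannian.SphericalCylinderEntropy
import Literature.Geometry.Manifold.CylinderSlice
import HarnessLib

/-!
# Radial Harnack monotonicity from log-convexity

Stub `stub_harnackRadial_of_convex` of line `ball-mass-slack` of the crux
`CylinderEntropy.ThinCrossSectionExists` (`stmt-SmoothPoincare4-7633`), proved with its registered
statement verbatim.  From the hypothesis (positivity of `θ ↦ zonal τ (cos θ)` and convexity of
`φ θ = log (zonal τ (cos θ)) + θ² / (4 τ)` on `[-π, π]`) we deduce that
`θ ↦ zonal τ (cos θ) · exp (θ² / (4 τ)) = exp (φ θ)` is non-decreasing on `[0, π]`: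
`φ` is even (`Real.cos_neg`, `neg_sq`), so convexity at the midpoint of `θ` and `-θ` gives
`φ 0 ≤ φ θ` on `[-π, π]`; the three-point lemma `ConvexOn.le_right_of_left_le''` then yields
monotonicity of `φ` on `[0, π]`, and `Real.exp_monotone` transports it to `exp ∘ φ`
(`Real.exp_add`, `Real.exp_log`).  `zonal` is treated as an opaque real function.

Everything here is proved; no facts and no `Prop`-valued definitions are introduced.
-/

noncomputable section

open scoped BigOperators Topology MeasureTheory ENNReal NNReal
open Set Function MeasureTheory
open Literature.Geometry.Riemannian.SphericalCylinderEntropy (cylEntropy cylDensity cylKernel zonal wt gegen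
  cylKernel_eq abs_sum_mul_le_one hausdorffMeasure_sphere_four_pos hausdorffMeasure_sphere_four_lt_top)
open Literature.Geometry.Manifold.CylinderSlice (sliceMap range_sliceMap)

set_option linter.dupNamespace false

namespace Summit.SmoothPoincare4.SmoothPoincare4.Theorems.ThinCrossSectionExists.BallMassSlack

namespace HarnackRadial

/-- An even function which is convex on `[-π, π]` attains its minimum over `[-π, π]` at `0`:
`φ 0 = φ (½θ + ½(-θ)) ≤ ½ φ θ + ½ φ (-θ) = φ θ`. [folklore] -/
theorem apply_zero_le_of_even_convexOn {φ : ℝ → ℝ}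
    (hconv : ConvexOn ℝ (Set.Icc (-Real.pi) Real.pi) φ) (heven : ∀ θ, φ (-θ) = φ θ)
    {θ : ℝ} (hθ : θ ∈ Set.Icc (-Real.pi) Real.pi) : φ 0 ≤ φ θ := by
  have hθ' : -θ ∈ Set.Icc (-Real.pi) Real.pi := by
    constructor <;> linarith [hθ.1, hθ.2]
  have h := hconv.2 hθ hθ' (by norm_num : (0 : ℝ) ≤ 1 / 2) (by norm_num : (0 : ℝ) ≤ 1 / 2)
    (by norm_num)
  have h0 : (1 / 2 : ℝ) • θ + (1 / 2 : ℝ) • (-θ) = 0 := by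
    simp only [smul_eq_mul]
    ring
  rw [h0, heven θ] at h
  simp only [smul_eq_mul] at h
  linarith

/-- An even function which is convex on `[-π, π]` is non-decreasing on `[0, π]`: it is minimised
at the left end point `0`, and the three-point inequality `ConvexOn.le_right_of_left_le''`
propagates `φ 0 ≤ φ a` to `φ a ≤ φ b` for `0 < a ≤ b ≤ π`. [folklore] -/
theorem monotoneOn_of_even_convexOn {φ : ℝ → ℝ}
    (hconv : ConvexOn ℝ (Set.Icc (-Real.pi) Real.pi) φ) (heven : ∀ θ, φ (-θ) = φ θ) :
    MonotoneOn φ (Set.Icc 0 Real.pi) := by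
  intro a ha b hb hab
  have hsub : Set.Icc 0 Real.pi ⊆ Set.Icc (-Real.pi) Real.pi :=
    Set.Icc_subset_Icc_left (by linarith [Real.pi_pos])
  have h0mem : (0 : ℝ) ∈ Set.Icc (-Real.pi) Real.pi :=
    ⟨by linarith [Real.pi_pos], Real.pi_pos.le⟩
  rcases ha.1.eq_or_lt with h | h
  · rw [← h]
    exact apply_zero_le_of_even_convexOn hconv heven (hsub hb)
  · exact hconv.le_right_of_left_le'' h0mem (hsub hb) h hab
      (apply_zero_le_of_even_convexOn hconv heven (hsub ha))

end HarnackRadial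

open HarnackRadial in
/-- **STUB A'** (radial Harnack monotonicity from Hamilton's convexity).  If for every `τ > 0` the
profile `θ ↦ zonal τ (cos θ)` is positive and `φ θ = log (zonal τ (cos θ)) + θ² / (4 τ)` is convex on
`[-π, π]`, then `θ ↦ zonal τ (cos θ) · exp (θ² / (4 τ))` is non-decreasing on `[0, π]`.  Proof: `φ` is
even, hence minimised at `0` and monotone on `[0, π]` (`HarnackRadial.monotoneOn_of_even_convexOn`);
the weighted kernel is `exp ∘ φ` (`Real.exp_add`, `Real.exp_log`) and `Real.exp` is monotone.
[folklore] -/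
theorem stub_harnackRadial_of_convex :
    (∀ τ : ℝ, 0 < τ →
        (∀ θ : ℝ, 0 < zonal τ (Real.cos θ)) ∧
          ConvexOn ℝ (Set.Icc (-Real.pi) Real.pi)
            (fun θ : ℝ => Real.log (zonal τ (Real.cos θ)) + θ ^ 2 / (4 * τ))) →
      ∀ τ : ℝ, 0 < τ →
        MonotoneOn (fun θ : ℝ => zonal τ (Real.cos θ) * Real.exp (θ ^ 2 / (4 * τ))) (Set.Icc 0 Real.pi) := by
  intro h τ hτ
  obtain ⟨hpos, hconv⟩ := h τ hτ
  have heven : ∀ θ : ℝ, Real.log (zonal τ (Real.cos (-θ))) + (-θ) ^ 2 / (4 * τ) =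
      Real.log (zonal τ (Real.cos θ)) + θ ^ 2 / (4 * τ) := by
    intro θ
    rw [Real.cos_neg, neg_sq]
  have hmono := monotoneOn_of_even_convexOn hconv heven
  have hEq : (fun θ : ℝ => zonal τ (Real.cos θ) * Real.exp (θ ^ 2 / (4 * τ))) =
      Real.exp ∘ (fun θ : ℝ => Real.log (zonal τ (Real.cos θ)) + θ ^ 2 / (4 * τ)) := by
    funext θ
    simp only [Function.comp_apply]
    rw [Real.exp_add, Real.exp_log (hpos θ)]
  rw [hEq]
  exact Real.exp_monotone.comp_monotoneOn hmono

end Summit.SmoothPoincare4.SmoothPoincare4.Theorems.ThinCrossSectionExists.BallMassSlack
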